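import Summits.ResolutionOfSingularities.ResolutionOfSingularities.Theorems.WeightedInvariantLocalWeightedDropNCDirectrixCut
import Summits.ResolutionOfSingularities.ResolutionOfSingularities.Theorems.WeightedInvariantLocalWeightedDropNCDirectrixCutApexLineCurve
import Summits.ResolutionOfSingularities.ResolutionOfSingularities.Theorems.WeightedInvariantLocalWeightedDropNCDirectrixCutApexPlaneSurface
import Summits.ResolutionOfSingularities.ResolutionOfSingularities.Theorems.WeightedInvariantLocalWeightedDropTameFourStartsWon

/-!
# `WeightedInvariant.LocalWeightedDrop` (stmt-ResolutionOfSingularities-8899), registered stub W′|₄ `stub_wildWideApexFourStartsWon`: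
# THE KERNEL CENSUS — W′|₄ VERBATIM from exactly THREE named leaves (W₃, FT₃, LOW₃); OX discharged, the door and PL₃'s surface half by name

[OURS · route `ResolutionOfSingularities/WeightedInvariant` · ENGINE crux `LocalWeightedDrop` (stmt-ResolutionOfSingularities-8899), skeleton v36
`ae852bbacee88029` (3 registered stubs: W′|₄ `stub_wildWideApexFourStartsWon`, W|₅₊, T|₅₊) · line `directrix-cut` of res-L1-w43-strat-1
(`g9/directrix_cut_line_v3f.lean` 37b4c92427ddabdc: W′|₄ ⟸ {W₃, FT₃, PL₃, door}, kernel-checked there modulo four stubs).  Candidates of the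
programme's own count game; nothing here is a statement of, or about, any manuscript; AI-written, weaker than expert review; counted 0; proves no
summit and closes no registered stub — it PINS what W′|₄ still needs.]

## What this file does (assembly of LANDED theorems + the strategist's fully proved §0, verbatim; no definition, no new axiom)

Since v3f was written, two of its four inputs became tree theorems: the DOOR `spaceNCRankDrop` (res-L1-w43-lead-1, `…TameFourStartsWon`,
p578911; = v3f's `stub_doorSpaceNCRankDrop` verbatim) and the surface half of PL₃ (`apexPlaneExit_three_of_lowEscape`: PL₃ ⟸ LOW₃ alone,
res-L1-w43-stub-4, `…NCDirectrixCutApexPlaneSurface`, p575689, over `GraphSurf.apexPlaneSurfaceThree` p574330).  The old-letter exit OX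
(`OldExit k m`, every `m`, every field) was fully proved by the strategist INSIDE the sketch (§0 `oldExit_any`: one point blow-up and
forgetting the history) but never filed; it is filed here verbatim.  Composing with the tree's `NCTransport.wildWideApexFourStartsWon_of_histCut`
(p547705) and `apexLineCurveExit_three` (p547635):

* `wildWideApexFourStartsWon_of_three` — **W′|₄ VERBATIM ⟸ W₃ ∧ FT₃ ∧ PL₃** (door and OX discharged);
* `wildWideApexFourStartsWon_of_leaves` — **W′|₄ VERBATIM ⟸ W₃ ∧ FT₃ ∧ LOW₃** (also PL₃'s surface half discharged), where
  - W₃ = `CoreUnaryWild p k 3` (v3f `stub_coreUnaryWildThree`; the strategist's finer cuts: unary position split → ORDER-`p` split F ✓ · T ✓ ·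
    R₂ ✓ (`…NCDirectrixCutSmoothPairTwo`, this hand) · C = PREP ⊕ RUN mod `CossartPiltant2019_exitMultiplicityP_independent'` (+ sub-gap (d2′)) ·
    odd-`p` core `stub_irredOutsideCPScopeOddP` (NOT in print) · letter/bad escapes · `stub_coreUnaryWildGoodThreeHigher`),
  - FT₃ = `FreeTame p k 3` (v3f `stub_freeTameThree`; Kawanoue–Matsuki-class marked game + dictionary, `g9/ft3_split_v2.lean`),
  - LOW₃ = the low-escape hypothesis of `apexPlaneExit_three_of_lowEscape` verbatim (`g9/pl3_split_v1.lean` `stub_apexPlaneLowEscapeThree`;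
    Cossart–Jannsen–Saito-class, open sub-case Q-LOW-1).
The hypothesis lists of these two theorems ARE the remaining-lemma census of the registered stub W′|₄.
-/

set_option linter.dupNamespace false -- mandated namespace of this single-conjunct summit

noncomputable section

namespace Summit.ResolutionOfSingularities.ResolutionOfSingularities.Theorems

namespace TameFourTupleDrop

namespace WildFourCensus

open MvPowerSeries Literature.AlgebraicGeometry.Resolution NCTransport

/-! ## §0 OX DISCHARGED (res-L1-w43-strat-1 `directrix_cut_line_v3f.lean` §0, verbatim): `OldExit k m` for every `m` and every field -/

section Forget

variable {k : Type} [Field k] {m : ℕ}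

/-- Forgetting the history keeps admissibility (`Admissible` reads only `f` and `E`). -/
theorem admissible_forgetO {b : MvPowerSeries (Fin (m + 1)) k} {δ : Decoration k m} (h : Admissible b δ) :
    Admissible b ⟨δ.f, δ.E, ∅, Finset.empty_subset _⟩ :=
  h

/-- The head of the history-free re-decoration is `(o, o)`. -/
theorem head_forgetO (δ : Decoration k m) :
    (⟨δ.f, δ.E, ∅, Finset.empty_subset _⟩ : Decoration k m).head = toLex (δ.o, δ.o) := by
  rw [Decoration.head, Decoration.c, Finset.card_empty]
  rfl

/-- **`OldExit k m` HOLDS FOR EVERY `m` AND EVERY FIELD — by one point blow-up and forgetting the history** (= `oldExit_of_forget` of the tree-ready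
`…NCDirectrixCutForget`, evidence 69857448e1b1f92a on stmt-8899).  From an admissibly decorated position with an old letter present, the identity point
move is B-permissible (`isBPermissible_point_X`); at every answer the transform `δ′` is admissible with `δ′.o ≤ δ.o` (`admissible_transform`,
`Decoration.o_transform_le`), and the re-decoration `(δ′.f, δ′.E, ∅)` is admissible with head `(o′, o′) < (o, o + |O|)`. -/
theorem oldExit_any : OldExit k m := by
  classical
  intro b δ hadm _ho hO
  refine DWinsTo.of_measure (germ := (Prod.fst : MvPowerSeries (Fin (m + 1)) k × Decoration k m → MvPowerSeries (Fin (m + 1)) k))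
    ({(b, δ)} : Set (MvPowerSeries (Fin (m + 1)) k × Decoration k m)) (fun _ => 0) ?_ (Set.mem_singleton _)
  intro τ hτ _
  rw [Set.mem_singleton_iff] at hτ
  subst hτ
  have hperm := isBPermissible_point_X δ
  have hf : δ.f ≠ 0 := hadm.2.1.ne_zero
  refine ⟨fun j => X j, fun _ => 1, hperm.1, ?_⟩
  intro c hc hc0 A G hfac hG
  obtain ⟨i, hci⟩ : ∃ i, c i ≠ 0 := Function.ne_iff.mp hc0
  set δ' : Decoration k m := δ.transform (fun j => X j) (fun _ => 1) c i with hδ'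
  have hadm' : Admissible (X 0 * TupleGame.slice i G) δ' := admissible_transform hadm hperm hc hfac hG hci
  have ho' : δ'.o ≤ δ.o := Decoration.o_transform_le hperm hc hf hci
  refine ⟨i, hci, (X 0 * TupleGame.slice i G, ⟨δ'.f, δ'.E, ∅, Finset.empty_subset _⟩), rfl, Or.inl (Or.inr ⟨admissible_forgetO hadm', ?_⟩)⟩
  show (⟨δ'.f, δ'.E, ∅, Finset.empty_subset _⟩ : Decoration k m).head < δ.head
  rw [head_forgetO, Decoration.head, Decoration.c, Prod.Lex.lt_iff]
  rcases ho'.lt_or_eq with hlt | heq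
  · exact Or.inl hlt
  · exact Or.inr ⟨heq, by rw [heq]; exact Nat.lt_add_of_pos_right (Finset.card_pos.mpr hO)⟩

/-- In the tree kernel's binder shape. -/
theorem oldExitThree : ∀ (p : ℕ), p.Prime → ∀ (k : Type) [Field k] [CharP k p] [IsAlgClosed k], OldExit k 3 :=
  fun _ _ _ _ _ _ => oldExit_any

end Forget

/-! ## §1 W′|₄ from three leaves -/

/-- **W′|₄ VERBATIM ⟸ W₃ ∧ FT₃ ∧ PL₃** — the registered stub `stub_wildWideApexFourStartsWon` of `LocalWeightedDrop` (skeleton v36) from the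
purely-inseparable unary core `CoreUnaryWild p k 3`, the free tame class `FreeTame p k 3` and the apex-plane exit `ApexPlaneExit k 3`; the door
(`spaceNCRankDrop`), the old-letter exit (§0 `oldExitThree`) and the apex-line/curve exit (`apexLineCurveExit_three`) are tree theorems fed to
`NCTransport.wildWideApexFourStartsWon_of_histCut`. [OURS · W′|₄ kernel census] -/
theorem wildWideApexFourStartsWon_of_three
    (hW : ∀ (p : ℕ), p.Prime → ∀ (k : Type) [Field k] [CharP k p] [IsAlgClosed k], CoreUnaryWild p k 3)
    (hFT : ∀ (p : ℕ), p.Prime → ∀ (k : Type) [Field k] [CharP k p] [IsAlgClosed k], FreeTame p k 3)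
    (hPL : ∀ (p : ℕ), p.Prime → ∀ (k : Type) [Field k] [CharP k p] [IsAlgClosed k], ApexPlaneExit k 3) :
    ∀ (p : ℕ), p.Prime → ∀ (k : Type) [Field k] [CharP k p] [IsAlgClosed k],
      (∀ m : ℕ, m < 4 → ∀ g : MvPowerSeries (Fin m) k,
        CobordantGame.IsSingular k g → CobordantGame.Won k m g) →
      ∀ (f : MvPowerSeries (Fin 4) k), CobordantGame.IsSingular k f →
      (∀ g : MvPowerSeries (Fin 4) k, CobordantGame.IsSingular k g → g.order < f.order →
        CobordantGame.Won k 4 g) →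
      ∀ (d : ℕ), f.order = d → p ∣ d →
      (∃ ℓ : Fin 4 → k, ∀ i j : Fin 4,
        MvPowerSeries.coeff (Finsupp.single i 1 + Finsupp.single j 1) f =
          MvPowerSeries.coeff (Finsupp.single i 1 + Finsupp.single j 1)
            ((∑ l, MvPowerSeries.C (ℓ l) * MvPowerSeries.X l) ^ 2)) →
      (2 < d → ∃ c₁ c₂ : Fin 4 → k, (∀ α β : k, α • c₁ + β • c₂ = 0 → α = 0 ∧ β = 0) ∧
        (∀ v : Fin 4 → k, CobordantChart.initEval (fun _ : Fin 4 => 1) (v + c₁) d f =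
          CobordantChart.initEval (fun _ : Fin 4 => 1) v d f) ∧
        (∀ v : Fin 4 → k, CobordantChart.initEval (fun _ : Fin 4 => 1) (v + c₂) d f =
          CobordantChart.initEval (fun _ : Fin 4 => 1) v d f)) →
      CobordantGame.Won k 4 f :=
  wildWideApexFourStartsWon_of_histCut hW hFT oldExitThree apexLineCurveExit_three hPL spaceNCRankDrop

/-- **W′|₄ VERBATIM ⟸ W₃ ∧ FT₃ ∧ LOW₃** — as `wildWideApexFourStartsWon_of_three`, with PL₃ replaced by its open half LOW₃ (the low-escape
hypothesis of `apexPlaneExit_three_of_lowEscape`, verbatim; the surface half is `GraphSurf.apexPlaneSurfaceThree`).  THIS HYPOTHESIS LIST IS THE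
REMAINING-LEMMA CENSUS OF THE REGISTERED STUB. [OURS · W′|₄ kernel census] -/
theorem wildWideApexFourStartsWon_of_leaves
    (hW : ∀ (p : ℕ), p.Prime → ∀ (k : Type) [Field k] [CharP k p] [IsAlgClosed k], CoreUnaryWild p k 3)
    (hFT : ∀ (p : ℕ), p.Prime → ∀ (k : Type) [Field k] [CharP k p] [IsAlgClosed k], FreeTame p k 3)
    (hlow : ∀ (p : ℕ), p.Prime → ∀ (k : Type) [Field k] [CharP k p] [IsAlgClosed k],
      ∀ (b : MvPowerSeries (Fin 4) k) (δ : Decoration k 3), Admissible b δ → 2 ≤ δ.o → δ.O = ∅ → ¬ UnaryVertex δ →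
        (∃ v₁ v₂ : Fin 4 → k,
          (∀ x : Fin 4 → k, CobordantChart.initEval (fun _ : Fin 4 => 1) (x + v₁) δ.c (δ.f * ∏ l ∈ δ.O, X l) =
            CobordantChart.initEval (fun _ : Fin 4 => 1) x δ.c (δ.f * ∏ l ∈ δ.O, X l)) ∧
          (∀ x : Fin 4 → k, CobordantChart.initEval (fun _ : Fin 4 => 1) (x + v₂) δ.c (δ.f * ∏ l ∈ δ.O, X l) =
            CobordantChart.initEval (fun _ : Fin 4 => 1) x δ.c (δ.f * ∏ l ∈ δ.O, X l)) ∧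
          ∀ α β : k, α • v₁ + β • v₂ = 0 → α = 0 ∧ β = 0) →
        (¬ ∃ (Φ : Fin 4 → MvPowerSeries (Fin 4) k) (a b' : Fin 4), (∀ l, constantCoeff (Φ l) = 0) ∧
          IsUnit (Matrix.det (Matrix.of fun i j : Fin 4 => coeff (Finsupp.single j 1) (Φ i))) ∧ a ≠ b' ∧
          (δ.c : ℕ∞) ≤ (subst Φ (δ.f * ∏ l ∈ δ.O, X l)).weightedOrder (fun j => if j = a ∨ j = b' then 0 else 1)) →
        DWinsTo (St := MvPowerSeries (Fin 4) k × Decoration k 3) Prod.fst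
          (fun τ => (GermIsNC τ.1 ∨ (Admissible τ.1 τ.2 ∧ τ.2.head < δ.head)) ∨
            (Admissible τ.1 τ.2 ∧ τ.2.head = δ.head ∧ ¬ UnaryVertex τ.2 ∧
              ((¬ ∃ v₁ v₂ : Fin 4 → k,
                (∀ x : Fin 4 → k, CobordantChart.initEval (fun _ : Fin 4 => 1) (x + v₁) τ.2.c (τ.2.f * ∏ l ∈ τ.2.O, X l) =
                  CobordantChart.initEval (fun _ : Fin 4 => 1) x τ.2.c (τ.2.f * ∏ l ∈ τ.2.O, X l)) ∧
                (∀ x : Fin 4 → k, CobordantChart.initEval (fun _ : Fin 4 => 1) (x + v₂) τ.2.c (τ.2.f * ∏ l ∈ τ.2.O, X l) =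
                  CobordantChart.initEval (fun _ : Fin 4 => 1) x τ.2.c (τ.2.f * ∏ l ∈ τ.2.O, X l)) ∧
                ∀ α β : k, α • v₁ + β • v₂ = 0 → α = 0 ∧ β = 0) ∨
              (∃ (Φ : Fin 4 → MvPowerSeries (Fin 4) k) (a b' : Fin 4), (∀ l, constantCoeff (Φ l) = 0) ∧
                IsUnit (Matrix.det (Matrix.of fun i j : Fin 4 => coeff (Finsupp.single j 1) (Φ i))) ∧ a ≠ b' ∧
                (τ.2.c : ℕ∞) ≤ (subst Φ (τ.2.f * ∏ l ∈ τ.2.O, X l)).weightedOrder (fun j => if j = a ∨ j = b' then 0 else 1))))) (b, δ)) :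
    ∀ (p : ℕ), p.Prime → ∀ (k : Type) [Field k] [CharP k p] [IsAlgClosed k],
      (∀ m : ℕ, m < 4 → ∀ g : MvPowerSeries (Fin m) k,
        CobordantGame.IsSingular k g → CobordantGame.Won k m g) →
      ∀ (f : MvPowerSeries (Fin 4) k), CobordantGame.IsSingular k f →
      (∀ g : MvPowerSeries (Fin 4) k, CobordantGame.IsSingular k g → g.order < f.order →
        CobordantGame.Won k 4 g) →
      ∀ (d : ℕ), f.order = d → p ∣ d →
      (∃ ℓ : Fin 4 → k, ∀ i j : Fin 4,
        MvPowerSeries.coeff (Finsupp.single i 1 + Finsupp.single j 1) f =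
          MvPowerSeries.coeff (Finsupp.single i 1 + Finsupp.single j 1)
            ((∑ l, MvPowerSeries.C (ℓ l) * MvPowerSeries.X l) ^ 2)) →
      (2 < d → ∃ c₁ c₂ : Fin 4 → k, (∀ α β : k, α • c₁ + β • c₂ = 0 → α = 0 ∧ β = 0) ∧
        (∀ v : Fin 4 → k, CobordantChart.initEval (fun _ : Fin 4 => 1) (v + c₁) d f =
          CobordantChart.initEval (fun _ : Fin 4 => 1) v d f) ∧
        (∀ v : Fin 4 → k, CobordantChart.initEval (fun _ : Fin 4 => 1) (v + c₂) d f =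
          CobordantChart.initEval (fun _ : Fin 4 => 1) v d f)) →
      CobordantGame.Won k 4 f :=
  wildWideApexFourStartsWon_of_three hW hFT (apexPlaneExit_three_of_lowEscape hlow)

end WildFourCensus

end TameFourTupleDrop

end Summit.ResolutionOfSingularities.ResolutionOfSingularities.Theorems

end
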